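import Summits.MatrixMultiplication.MatrixMultiplication.Theses.ThinBlockAlpha
import Summits.MatrixMultiplication.MatrixMultiplication.Theorems.ThinPackings.Negative.TriageRuledGraphPatternedArc
import Summits.MatrixMultiplication.MatrixMultiplication.Theorems.ThinBlockAlphaThinPackingsStubDeborderingPower
import Summits.MatrixMultiplication.MatrixMultiplication.Theorems.ThinBlockAlphaThinPackingsStubBoxFreiman
import Summits.MatrixMultiplication.MatrixMultiplication.Theorems.ThinBlockAlphaThinPackingsStubGradedFrames
import Summits.MatrixMultiplication.MatrixMultiplication.Theorems.ThinBlockAlphaThinPackingsStubGeneralBridge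

/-!
# Line `label-weighted-stpp-debordering` — checked skeleton for crux `ThinPackings` (lead's reshape v3)
(stmt-MatrixMultiplication-10595, route `ThinBlockAlpha`)

Planner `planner-cruxplan-stmt-MatrixMultiplication-10595-label-weighted-stpp--0` (crux-plan, round 1,
2026-08-16); idea card `Cruxes/ThinPackings/Ideas/label-weighted-stpp-debordering.md` (ideator 3); triage
TRIAGE-r1-1 §D, r1-2 (Part C of `Theorems/ThinPackings/Negative/TriageRuledGraphPatternedArc.lean`), r1-3; line
card `Cruxes/ThinPackings/Lines/label-weighted-stpp-debordering.md`; lead prover-line-stmt-MatrixMultiplication-10595-0.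

## The line

The crux `ThinPackings` asks, for every shape exponent `a < 1` and slack `η > 0`, for a two-leg-tight family of
thin STPP blocks `⟨N, M, N⟩`, `M ≥ N^a`, in some finite abelian group.  The line replaces `IsSTPP` by the
LABEL-WEIGHTED STPP (`Triage2.IsLabelWeightedSTPP`, a monomial degeneration of the group tensor with
block-constant potentials `κ, μ`: a cross relation with labels `(i, j, k)` not all equal is ADMISSIBLE when its
weight `(κ i − κ k) + (μ j − μ k)` is `≥ 1`) and carries such families to the crux by two TOOLS, both LANDED
in wave 1:

* `stub_deborderingPower` (p78947; de-bordering, the STPP mirror image of BCCGNSU 2017 Lemma 3.4): in `Hⁿ` the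
  product blocks of one weight-sum class form a genuine `IsSTPP` family of `≥ Lⁿ/(2nR+1)²` blocks
  `⟨Nⁿ, Mⁿ, Nⁿ⟩`; `debordering : WeightedThinPackings → ThinPackings` is proved below from it;
* `stub_boxFreiman` (p79988; Freiman box transfer): a label-weighted family of integer vectors in `[-b, b]^D`
  stays label-weighted, with the same potentials and cardinalities, modulo any `m > 6b`.

The CONSTRUCTION side are ORTHOGONAL FRAMES ON SPHERES in `ℤ^D`: within block `i` the three legs are pointwise
orthogonal and lie on spheres of squared radii `rA i`, `rB i`, `rC i`.  One Pythagoras step then pays for the TPP of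
every block and turns every two-label cross relation into a STRICT increase of the relevant pair radius
(`E = rA + rB` for pattern `j = k ≠ i`, `F = rB + rC` for `i = k ≠ j`, the tile radius `T = rA + rC` for
`i = j ≠ k`), so that ORDER-COMPATIBLE potentials (`κ` increasing along `E`, `μ` along `F`, `κ + μ` DEcreasing
along `T`, each by integer steps) make the weighted family condition EQUIVALENT to the three packings plus the
all-distinct clause restricted to the triples of non-positive weight (`stub_generalBridge`, LANDED p81634 —
reshape v3, adopting the drefuter's sharpening `GeneralBridge.lean` of 2026-08-16T04:47Z; the v1/v2 bridge
`stub_gradedFrames`, LANDED p79783, is its one-parameter case `rA = xA + α d`, `rB = xB − β d`, `rC = xC + γ d`,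
`κ = μ = −d`, see `generalFrameDesigns_of_multiRadiusFrameDesigns`).  What is left is the open design statement
`stub_generalFrameDesigns` (hardest stub, the crux's difficulty localised): such frame systems exist in boxes
`[-b, b]^D`, two-leg tight for the host `(ℤ/(6b+1))^D`.  It is WEAKER than v2's `MultiRadiusFrameDesigns`
(proved implication below) and than the sphere line's `stub_frameDesign` (constant radii).

Composition (closed term; after waves 1–2 the ONLY `sorry` is the design stub `stub_generalFrameDesigns`):
`ThinPackings_of = debordering stub_deborderingPower
   (weightedThinPackings_of_generalFrames stub_boxFreiman stub_generalBridge stub_generalFrameDesigns)`.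

## Disproof.lean / drefute used

Disproof.lean (cdisprove cycle 2 final, 1765 lines): no `_false_without_` theorem, no §4 Target; §7 costume
theorem `thinPackings_iff_cThesis` (crux ≡ X_C) conceded — the design stub is ≥ X_C-hard by the landed tools;
§3b/§6/§8 honoured as in v1 (many blocks `L ≥ N^{a−η}`, `N → ∞`, exponent `6b+1 → ∞`, slack built in, no leg of
translates).  drefute (2026-08-16T03:41–04:47Z): all three v2 tool stubs independently PROVED; design stub survived
the cheap arsenal; necessities `L·N² ≤ (4b+1)^D`, `N^η ≥ ((6b+1)/(4b+1))^D` (so `b ≥ ½(1.5^{2/η} − 1)`), coordinate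
graded frames witness exactly the true region `η > a` (so `a = 0` holds inside the ansatz), multi-radius dividend
over one sphere ≤ layer factor; sharpening = the general bridge adopted here.
-/

set_option linter.dupNamespace false

namespace Summit.MatrixMultiplication.MatrixMultiplication.Cruxes.ThinPackings.LabelWeightedStppDebordering

open Finset Filter
open Literature.Computability.AlgebraicComplexity (IsSTPP)
open Summit.MatrixMultiplication.MatrixMultiplication.Theses.ThinBlockAlpha (ThinPackings)
open Summit.MatrixMultiplication.MatrixMultiplication.Theorems.ThinPackings.Negative.Triage2 (IsLabelWeightedSTPP)

/-! ## Objects -/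

/-- **Weighted thin packings** — the transferred form `C⁺` of the crux: `ThinPackings` with `IsSTPP` relaxed to
`IsLabelWeightedSTPP`, potentials bounded by `R` (any `R`; the bound is only recorded for the de-bordering count). -/
def WeightedThinPackings : Prop :=
  ∀ a : ℝ, 0 ≤ a → a < 1 → ∀ η : ℝ, 0 < η → ∃ (H : Type) (_ : AddCommGroup H) (_ : Fintype H)
    (L N M R : ℕ) (A B C : Fin L → Finset H) (κ μ : Fin L → ℤ), IsLabelWeightedSTPP A B C κ μ ∧
    (∀ i, (A i).card = N ∧ (B i).card = M ∧ (C i).card = N) ∧ 2 ≤ N ∧ (N : ℝ) ^ a ≤ M ∧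
    (∀ i, |κ i| ≤ R ∧ |μ i| ≤ R) ∧ (Fintype.card H : ℝ) ≤ L * (N : ℝ) ^ (2 + η)

/-- **De-bordering** (the card's first lemma, by name): `C⁺ → ThinPackings`. -/
def Debordering : Prop := WeightedThinPackings → ThinPackings

/-- Coordinatewise reduction `ℤ^D → (ℤ/m)^D` (the Freiman box embedding). -/
def boxCast (D m : ℕ) (v : Fin D → ℤ) : Fin D → ZMod m := fun t => (v t : ZMod m)

/-- All legs of all blocks lie in the box `[-b, b]^D`. -/
def InBox {D L : ℕ} (A B C : Fin L → Finset (Fin D → ℤ)) (b : ℕ) : Prop :=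
  ∀ i, (∀ v ∈ A i, ∀ t, |v t| ≤ b) ∧ (∀ v ∈ B i, ∀ t, |v t| ≤ b) ∧ (∀ v ∈ C i, ∀ t, |v t| ≤ b)

/-- **Orthogonal frame family**: inside every block the three legs are pointwise orthogonal. -/
def IsFrameFamily {D L : ℕ} (A B C : Fin L → Finset (Fin D → ℤ)) : Prop :=
  (∀ i, ∀ x ∈ A i, ∀ y ∈ B i, x ⬝ᵥ y = 0) ∧ (∀ i, ∀ x ∈ A i, ∀ z ∈ C i, x ⬝ᵥ z = 0) ∧
  (∀ i, ∀ y ∈ B i, ∀ z ∈ C i, y ⬝ᵥ z = 0)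

/-- **Spheres with arbitrary per-block radii** `rA i`, `rB i`, `rC i` (reshape v3). -/
def OnSpheres {D L : ℕ} (A B C : Fin L → Finset (Fin D → ℤ)) (rA rB rC : Fin L → ℤ) : Prop :=
  (∀ i, ∀ x ∈ A i, x ⬝ᵥ x = rA i) ∧ (∀ i, ∀ y ∈ B i, y ⬝ᵥ y = rB i) ∧ (∀ i, ∀ z ∈ C i, z ⬝ᵥ z = rC i)

/-- **Order-compatible potentials** (reshape v3): `κ` increases (by integer steps) along the pair radius
`E = rA + rB`, `μ` along `F = rB + rC`, and `κ + μ` DEcreases along the tile radius `T = rA + rC`. -/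
def OrderCompatible {L : ℕ} (rA rB rC κ μ : Fin L → ℤ) : Prop :=
  (∀ i k, rA k + rB k < rA i + rB i → κ k + 1 ≤ κ i) ∧ (∀ i k, rB k + rC k < rB i + rC i → μ k + 1 ≤ μ i) ∧
  (∀ i k, rA i + rC i < rA k + rC k → κ k + μ k + 1 ≤ κ i + μ i)

/-- **Residual clauses** for potentials `κ, μ`: the three packings and the all-distinct-label clause restricted
to the triples of NON-POSITIVE weight `(κ i − κ k) + (μ j − μ k) ≤ 0` (the others are paid by the weight). -/
def GeneralResidualClauses {H : Type*} [AddCommGroup H] {L : ℕ} (A B C : Fin L → Finset H)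
    (κ μ : Fin L → ℤ) : Prop :=
  (∀ i k, ∀ a ∈ A i, ∀ c ∈ C i, ∀ a' ∈ A k, ∀ c' ∈ C k, c - a = c' - a' → i = k ∧ a = a' ∧ c = c') ∧
  (∀ i k, ∀ a ∈ A i, ∀ b ∈ B i, ∀ a' ∈ A k, ∀ b' ∈ B k, b - a = b' - a' → i = k ∧ a = a' ∧ b = b') ∧
  (∀ i k, ∀ b ∈ B i, ∀ c ∈ C i, ∀ b' ∈ B k, ∀ c' ∈ C k, b - c = b' - c' → i = k ∧ b = b' ∧ c = c') ∧
  (∀ i j k : Fin L, i ≠ j → j ≠ k → i ≠ k → (κ i - κ k) + (μ j - μ k) ≤ 0 →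
      ∀ s ∈ A k, ∀ s' ∈ A i, ∀ t ∈ B i, ∀ t' ∈ B j, ∀ u ∈ C j, ∀ u' ∈ C k,
        (s' - s) + (t' - t) + (u' - u) ≠ 0)

/-- (v1/v2 vocabulary, kept for the comparison theorem) graded spheres with affine radii. -/
def OnGradedSpheres {D L : ℕ} (A B C : Fin L → Finset (Fin D → ℤ)) (d : Fin L → ℤ)
    (xA xB xC α β γ : ℤ) : Prop :=
  (∀ i, ∀ x ∈ A i, x ⬝ᵥ x = xA + α * d i) ∧ (∀ i, ∀ y ∈ B i, y ⬝ᵥ y = xB - β * d i) ∧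
  (∀ i, ∀ z ∈ C i, z ⬝ᵥ z = xC + γ * d i)

/-- (v1/v2 vocabulary) admissible slopes. -/
def AdmissibleSlopes (α β γ : ℤ) : Prop := 0 ≤ α ∧ 0 ≤ γ ∧ 1 ≤ α + γ ∧ α < β ∧ γ < β

/-- (v1/v2 vocabulary) residual clauses for the grading `d` (distinct clause on the non-convex triples). -/
def ResidualClauses {H : Type*} [AddCommGroup H] {L : ℕ} (A B C : Fin L → Finset H) (d : Fin L → ℤ) :
    Prop :=
  (∀ i k, ∀ a ∈ A i, ∀ c ∈ C i, ∀ a' ∈ A k, ∀ c' ∈ C k, c - a = c' - a' → i = k ∧ a = a' ∧ c = c') ∧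
  (∀ i k, ∀ a ∈ A i, ∀ b ∈ B i, ∀ a' ∈ A k, ∀ b' ∈ B k, b - a = b' - a' → i = k ∧ a = a' ∧ b = b') ∧
  (∀ i k, ∀ b ∈ B i, ∀ c ∈ C i, ∀ b' ∈ B k, ∀ c' ∈ C k, b - c = b' - c' → i = k ∧ b = b' ∧ c = c') ∧
  (∀ i j k : Fin L, i ≠ j → j ≠ k → i ≠ k → 2 * d k ≤ d i + d j →
      ∀ s ∈ A k, ∀ s' ∈ A i, ∀ t ∈ B i, ∀ t' ∈ B j, ∀ u ∈ C j, ∀ u' ∈ C k,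
        (s' - s) + (t' - t) + (u' - u) ≠ 0)

/-! ## Stub statements (named `Prop`s; the registered signatures below are their explicit unfoldings) -/

/-- Statement of `stub_deborderingPower` — de-bordering, finite core. [LANDED p78947] -/
def DeborderingPower : Prop :=
  ∀ (H : Type) [AddCommGroup H] (L N M R : ℕ) (A B C : Fin L → Finset H) (κ μ : Fin L → ℤ),
    IsLabelWeightedSTPP A B C κ μ → (∀ i, (A i).card = N ∧ (B i).card = M ∧ (C i).card = N) →
    (∀ i, |κ i| ≤ R ∧ |μ i| ≤ R) →
    ∀ n : ℕ, ∃ (L' : ℕ) (A' B' C' : Fin L' → Finset (Fin n → H)),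
      IsSTPP A' B' C' ∧ (∀ i, (A' i).card = N ^ n ∧ (B' i).card = M ^ n ∧ (C' i).card = N ^ n) ∧
      L ^ n ≤ L' * (2 * n * R + 1) ^ 2

/-- Statement of `stub_boxFreiman` — Freiman box transfer. [LANDED p79988] -/
def BoxFreimanTransfer : Prop :=
  ∀ (D L b m : ℕ) (A B C : Fin L → Finset (Fin D → ℤ)) (κ μ : Fin L → ℤ),
    6 * b < m → InBox A B C b → IsLabelWeightedSTPP A B C κ μ →
    IsLabelWeightedSTPP (fun i => (A i).image (boxCast D m)) (fun i => (B i).image (boxCast D m))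
        (fun i => (C i).image (boxCast D m)) κ μ ∧
    (∀ i, ((A i).image (boxCast D m)).card = (A i).card ∧
      ((B i).image (boxCast D m)).card = (B i).card ∧ ((C i).image (boxCast D m)).card = (C i).card)

/-- Statement of `stub_generalBridge` — ORDER-COMPATIBLE FRAMES ARE WEIGHTED (reshape v3; the drefuter's
sharpening of `stub_gradedFrames`): for an orthogonal frame family on spheres of arbitrary per-block radii and
order-compatible potentials, `IsLabelWeightedSTPP A B C κ μ ↔ GeneralResidualClauses A B C κ μ`.
`→`: clauses (1)–(3) are the packings; clause (5) forbids the relations of weight `≤ 0`.  `←`: TPP by Pythagoras;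
pattern `(i,i,k)`: `‖u' − s‖² = ‖u − s'‖² + ‖t − t'‖²`, so `t = t'` (a `C − A` collision, excluded by packing
(1)) or `T k ≥ T i + 1`, and order-compatibility (3) gives weight `(κ i + μ i) − (κ k + μ k) ≥ 1`; pattern
`(i,j,j)`: `E i = E k + ‖u − u'‖²`, collision of packing (2) or `κ i ≥ κ k + 1` = the weight; pattern `(i,j,i)`:
`F j = F i + ‖s − s'‖²`, collision of packing (3) or `μ j ≥ μ i + 1` = the weight; all-distinct: weight `≥ 1`
or excluded.  Uses only `v ⬝ᵥ v ≥ 1` for `v ≠ 0` in `ℤ^D`. [M, provable now; helper lemmas of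
`Theorems/ThinBlockAlphaThinPackingsStubGradedFrames.lean` (`GradedFrames.normSq_sub`, `one_le_normSq`,
`eq_zero_of_orth_sum`, `norm_transfer`) are importable] -/
def GeneralBridge : Prop :=
  ∀ (D L : ℕ) (A B C : Fin L → Finset (Fin D → ℤ)) (rA rB rC κ μ : Fin L → ℤ),
    IsFrameFamily A B C → OnSpheres A B C rA rB rC → OrderCompatible rA rB rC κ μ →
    (IsLabelWeightedSTPP A B C κ μ ↔ GeneralResidualClauses A B C κ μ)

/-- Statement of `stub_generalFrameDesigns` — THE CONSTRUCTION (open; the hardest stub; reshape v3): for every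
`a < 1`, `η > 0` there are an orthogonal frame family on spheres of per-block radii `rA, rB, rC` in a box
`[-b, b]^D`, order-compatible potentials `κ, μ` bounded by `R`, satisfying the general residual clauses, with
blocks `⟨N, M, N⟩`, `N ≥ 2`, `M ≥ N^a`, two-leg tight for the host `(ℤ/(6b+1))^D`: `(6b+1)^D ≤ L·N^{2+η}`.
Contains v2's `MultiRadiusFrameDesigns` (`generalFrameDesigns_of_multiRadiusFrameDesigns`) and the sphere line's
single-radius designs.  Necessary (drefuter, `FrameDesignBoxCount`): `L·N² ≤ (4b+1)^D`, hence
`N^η ≥ ((6b+1)/(4b+1))^D` and `b ≥ ½(1.5^{2/η} − 1)`; known designs (coordinate frames, common leg) reach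
exactly the crux's true region `η > a`. [XL, open design problem] -/
def GeneralFrameDesigns : Prop :=
  ∀ a : ℝ, 0 ≤ a → a < 1 → ∀ η : ℝ, 0 < η →
    ∃ (D L N M b R : ℕ) (A B C : Fin L → Finset (Fin D → ℤ)) (rA rB rC κ μ : Fin L → ℤ),
      IsFrameFamily A B C ∧ OnSpheres A B C rA rB rC ∧ OrderCompatible rA rB rC κ μ ∧
      GeneralResidualClauses A B C κ μ ∧
      (∀ i, (A i).card = N ∧ (B i).card = M ∧ (C i).card = N) ∧ 2 ≤ N ∧ (N : ℝ) ^ a ≤ M ∧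
      InBox A B C b ∧ (∀ i, |κ i| ≤ R ∧ |μ i| ≤ R) ∧
      (((6 * b + 1 : ℕ) : ℝ)) ^ D ≤ L * (N : ℝ) ^ (2 + η)

/-- (v2's design statement, kept for comparison) multi-radius frame designs with affine grading. -/
def MultiRadiusFrameDesigns : Prop :=
  ∀ a : ℝ, 0 ≤ a → a < 1 → ∀ η : ℝ, 0 < η →
    ∃ (D L N M b R : ℕ) (A B C : Fin L → Finset (Fin D → ℤ)) (d : Fin L → ℤ) (xA xB xC α β γ : ℤ),
      AdmissibleSlopes α β γ ∧ IsFrameFamily A B C ∧ OnGradedSpheres A B C d xA xB xC α β γ ∧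
      ResidualClauses A B C d ∧
      (∀ i, (A i).card = N ∧ (B i).card = M ∧ (C i).card = N) ∧ 2 ≤ N ∧ (N : ℝ) ^ a ≤ M ∧
      InBox A B C b ∧ (∀ i, |d i| ≤ R) ∧
      (((6 * b + 1 : ℕ) : ℝ)) ^ D ≤ L * (N : ℝ) ^ (2 + η)

/-! ## Registered stubs (explicit tree vocabulary; the ONLY `sorry` left is the design stub `stub_generalFrameDesigns`;
the composition with that stub as an explicit hypothesis is LANDED as
`Theorems/ThinBlockAlphaThinPackingsDebordering.lean: thinPackings_of_generalFrameDesigns` (p84200)) -/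

/-- **stub_deborderingPower** — de-bordering, finite core (`= DeborderingPower`). LANDED p78947
(`Theorems/ThinBlockAlphaThinPackingsStubDeborderingPower.lean`, wave 1). -/
theorem stub_deborderingPower :
    ∀ (H : Type) [AddCommGroup H] (L N M R : ℕ) (A B C : Fin L → Finset H) (κ μ : Fin L → ℤ),
      IsLabelWeightedSTPP A B C κ μ → (∀ i, (A i).card = N ∧ (B i).card = M ∧ (C i).card = N) →
      (∀ i, |κ i| ≤ R ∧ |μ i| ≤ R) →
      ∀ n : ℕ, ∃ (L' : ℕ) (A' B' C' : Fin L' → Finset (Fin n → H)),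
        IsSTPP A' B' C' ∧ (∀ i, (A' i).card = N ^ n ∧ (B' i).card = M ^ n ∧ (C' i).card = N ^ n) ∧
        L ^ n ≤ L' * (2 * n * R + 1) ^ 2 :=
  Summit.MatrixMultiplication.MatrixMultiplication.Theorems.ThinPackings.stub_deborderingPower

/-- **stub_boxFreiman** — Freiman box transfer of label-weighted families (`= BoxFreimanTransfer`). LANDED p79988
(`Theorems/ThinBlockAlphaThinPackingsStubBoxFreiman.lean`, wave 1). -/
theorem stub_boxFreiman :
    ∀ (D L b m : ℕ) (A B C : Fin L → Finset (Fin D → ℤ)) (κ μ : Fin L → ℤ),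
      6 * b < m →
      (∀ i, (∀ v ∈ A i, ∀ t, |v t| ≤ (b : ℤ)) ∧ (∀ v ∈ B i, ∀ t, |v t| ≤ (b : ℤ)) ∧
        (∀ v ∈ C i, ∀ t, |v t| ≤ (b : ℤ))) →
      IsLabelWeightedSTPP A B C κ μ →
      IsLabelWeightedSTPP (fun i => (A i).image (fun (v : Fin D → ℤ) (t : Fin D) => (v t : ZMod m)))
          (fun i => (B i).image (fun (v : Fin D → ℤ) (t : Fin D) => (v t : ZMod m)))
          (fun i => (C i).image (fun (v : Fin D → ℤ) (t : Fin D) => (v t : ZMod m))) κ μ ∧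
      (∀ i, ((A i).image (fun (v : Fin D → ℤ) (t : Fin D) => (v t : ZMod m))).card = (A i).card ∧
        ((B i).image (fun (v : Fin D → ℤ) (t : Fin D) => (v t : ZMod m))).card = (B i).card ∧
        ((C i).image (fun (v : Fin D → ℤ) (t : Fin D) => (v t : ZMod m))).card = (C i).card) :=
  Summit.MatrixMultiplication.MatrixMultiplication.Theorems.ThinPackings.stub_boxFreiman

/-- **stub_generalBridge** — order-compatible orthogonal frames on spheres are label-weighted (Pythagoras)
(`= GeneralBridge`). LANDED p81634 (`Theorems/ThinBlockAlphaThinPackingsStubGeneralBridge.lean`, lead). -/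
theorem stub_generalBridge :
    ∀ (D L : ℕ) (A B C : Fin L → Finset (Fin D → ℤ)) (rA rB rC κ μ : Fin L → ℤ),
      ((∀ i, ∀ x ∈ A i, ∀ y ∈ B i, x ⬝ᵥ y = 0) ∧ (∀ i, ∀ x ∈ A i, ∀ z ∈ C i, x ⬝ᵥ z = 0) ∧
        (∀ i, ∀ y ∈ B i, ∀ z ∈ C i, y ⬝ᵥ z = 0)) →
      ((∀ i, ∀ x ∈ A i, x ⬝ᵥ x = rA i) ∧ (∀ i, ∀ y ∈ B i, y ⬝ᵥ y = rB i) ∧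
        (∀ i, ∀ z ∈ C i, z ⬝ᵥ z = rC i)) →
      ((∀ i k, rA k + rB k < rA i + rB i → κ k + 1 ≤ κ i) ∧
        (∀ i k, rB k + rC k < rB i + rC i → μ k + 1 ≤ μ i) ∧
        (∀ i k, rA i + rC i < rA k + rC k → κ k + μ k + 1 ≤ κ i + μ i)) →
      (IsLabelWeightedSTPP A B C κ μ ↔
        ((∀ i k, ∀ a ∈ A i, ∀ c ∈ C i, ∀ a' ∈ A k, ∀ c' ∈ C k, c - a = c' - a' → i = k ∧ a = a' ∧ c = c') ∧
         (∀ i k, ∀ a ∈ A i, ∀ b ∈ B i, ∀ a' ∈ A k, ∀ b' ∈ B k, b - a = b' - a' → i = k ∧ a = a' ∧ b = b') ∧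
         (∀ i k, ∀ b ∈ B i, ∀ c ∈ C i, ∀ b' ∈ B k, ∀ c' ∈ C k, b - c = b' - c' → i = k ∧ b = b' ∧ c = c') ∧
         (∀ i j k : Fin L, i ≠ j → j ≠ k → i ≠ k → (κ i - κ k) + (μ j - μ k) ≤ 0 →
            ∀ s ∈ A k, ∀ s' ∈ A i, ∀ t ∈ B i, ∀ t' ∈ B j, ∀ u ∈ C j, ∀ u' ∈ C k,
              (s' - s) + (t' - t) + (u' - u) ≠ 0))) :=
  Summit.MatrixMultiplication.MatrixMultiplication.Theorems.ThinPackings.stub_generalBridge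

/-- **stub_generalFrameDesigns** — existence of two-leg-tight order-compatible frame designs in boxes
(`= GeneralFrameDesigns`). [XL, OPEN — the hardest stub; the crux's difficulty localised; held by the lead] -/
theorem stub_generalFrameDesigns :
    ∀ a : ℝ, 0 ≤ a → a < 1 → ∀ η : ℝ, 0 < η →
      ∃ (D L N M b R : ℕ) (A B C : Fin L → Finset (Fin D → ℤ)) (rA rB rC κ μ : Fin L → ℤ),
        ((∀ i, ∀ x ∈ A i, ∀ y ∈ B i, x ⬝ᵥ y = 0) ∧ (∀ i, ∀ x ∈ A i, ∀ z ∈ C i, x ⬝ᵥ z = 0) ∧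
          (∀ i, ∀ y ∈ B i, ∀ z ∈ C i, y ⬝ᵥ z = 0)) ∧
        ((∀ i, ∀ x ∈ A i, x ⬝ᵥ x = rA i) ∧ (∀ i, ∀ y ∈ B i, y ⬝ᵥ y = rB i) ∧
          (∀ i, ∀ z ∈ C i, z ⬝ᵥ z = rC i)) ∧
        ((∀ i k, rA k + rB k < rA i + rB i → κ k + 1 ≤ κ i) ∧
          (∀ i k, rB k + rC k < rB i + rC i → μ k + 1 ≤ μ i) ∧
          (∀ i k, rA i + rC i < rA k + rC k → κ k + μ k + 1 ≤ κ i + μ i)) ∧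
        ((∀ i k, ∀ a ∈ A i, ∀ c ∈ C i, ∀ a' ∈ A k, ∀ c' ∈ C k, c - a = c' - a' → i = k ∧ a = a' ∧ c = c') ∧
         (∀ i k, ∀ a ∈ A i, ∀ b ∈ B i, ∀ a' ∈ A k, ∀ b' ∈ B k, b - a = b' - a' → i = k ∧ a = a' ∧ b = b') ∧
         (∀ i k, ∀ b ∈ B i, ∀ c ∈ C i, ∀ b' ∈ B k, ∀ c' ∈ C k, b - c = b' - c' → i = k ∧ b = b' ∧ c = c') ∧
         (∀ i j k : Fin L, i ≠ j → j ≠ k → i ≠ k → (κ i - κ k) + (μ j - μ k) ≤ 0 →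
            ∀ s ∈ A k, ∀ s' ∈ A i, ∀ t ∈ B i, ∀ t' ∈ B j, ∀ u ∈ C j, ∀ u' ∈ C k,
              (s' - s) + (t' - t) + (u' - u) ≠ 0)) ∧
        (∀ i, (A i).card = N ∧ (B i).card = M ∧ (C i).card = N) ∧ 2 ≤ N ∧ (N : ℝ) ^ a ≤ M ∧
        (∀ i, (∀ v ∈ A i, ∀ t, |v t| ≤ (b : ℤ)) ∧ (∀ v ∈ B i, ∀ t, |v t| ≤ (b : ℤ)) ∧
          (∀ v ∈ C i, ∀ t, |v t| ≤ (b : ℤ))) ∧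
        (∀ i, |κ i| ≤ (R : ℤ) ∧ |μ i| ≤ (R : ℤ)) ∧
        (((6 * b + 1 : ℕ) : ℝ)) ^ D ≤ L * (N : ℝ) ^ (2 + η) := by
  sorry

/-! The registered signatures ARE the named statements (definitional unfolding only). -/

example : DeborderingPower := stub_deborderingPower
example : BoxFreimanTransfer := stub_boxFreiman
example : GeneralBridge := stub_generalBridge
example : GeneralFrameDesigns := stub_generalFrameDesigns

/-! ## Composition (real proofs, no `sorry` below this line) -/

/-- Exponentials beat squares: for `r > 1` and any `K` some `n ≥ 1` has `K·n² ≤ rⁿ`. -/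
theorem exists_sq_le_pow {r : ℝ} (hr : 1 < r) (K : ℝ) : ∃ n : ℕ, 1 ≤ n ∧ K * (n : ℝ) ^ 2 ≤ r ^ n := by
  by_cases hK : K ≤ 0
  · refine ⟨1, le_rfl, ?_⟩
    have : K * ((1 : ℕ) : ℝ) ^ 2 ≤ 0 := by
      simp only [Nat.cast_one, one_pow, mul_one]; exact hK
    exact this.trans (by positivity)
  · have hK : 0 < K := lt_of_not_ge hK
    have hlim := tendsto_pow_const_div_const_pow_of_one_lt 2 hr
    have hε : (0 : ℝ) < 1 / K := by positivity
    obtain ⟨n, hn, hn1⟩ := ((hlim.eventually (gt_mem_nhds hε)).and (eventually_ge_atTop 1)).exists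
    refine ⟨n, hn1, ?_⟩
    have hrn : (0 : ℝ) < r ^ n := pow_pos (by linarith) n
    have h1 : (n : ℝ) ^ 2 < 1 / K * r ^ n := (div_lt_iff₀ hrn).1 hn
    have h2 : K * (n : ℝ) ^ 2 < K * (1 / K * r ^ n) := mul_lt_mul_of_pos_left h1 hK
    have h3 : K * (1 / K * r ^ n) = r ^ n := by field_simp
    linarith

/-- **`C⁺ → ThinPackings`** (the card's `Debordering`, from the finite core): take a weighted family at slack
`η/2`, tensor up `n` times with `(2nR+1)² ≤ N^{nη/2}`, keep the popular weight class. -/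
theorem debordering (hP : DeborderingPower) : Debordering := by
  intro hW a ha0 ha1 η hη
  obtain ⟨H, hH1, hH2, L, N, M, R, A, B, C, κ, μ, hLW, hc, hN, hM, hR, hH⟩ :=
    hW a ha0 ha1 (η / 2) (by positivity)
  have hN1 : (1 : ℝ) < N := by exact_mod_cast (by omega : 1 < N)
  have hNpos : (0 : ℝ) < N := by linarith
  have hN0 : (0 : ℝ) ≤ N := hNpos.le
  -- choose the tensor power
  set r : ℝ := (N : ℝ) ^ (η / 2) with hr
  have hr1 : 1 < r := Real.one_lt_rpow hN1 (by positivity)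
  obtain ⟨n, hn1, hn⟩ := exists_sq_le_pow hr1 (((2 * R + 1 : ℕ) : ℝ) ^ 2)
  obtain ⟨L', A', B', C', hS, hc', hL'⟩ := hP H L N M R A B C κ μ hLW hc hR n
  refine ⟨Fin n → H, inferInstance, inferInstance, L', N ^ n, M ^ n, A', B', C', hS, hc', ?_, ?_, ?_⟩
  · -- 2 ≤ N ^ n
    calc 2 ≤ N := hN
      _ = N ^ 1 := (pow_one N).symm
      _ ≤ N ^ n := Nat.pow_le_pow_right (by omega) hn1
  · -- (N^n)^a ≤ M^n
    have h0 : (0 : ℝ) ≤ (N : ℝ) ^ a := by positivity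
    push_cast
    rw [← Real.rpow_natCast_mul hN0, mul_comm, Real.rpow_mul_natCast hN0]
    exact pow_le_pow_left₀ h0 hM n
  · -- the packing count
    have hcardH : (0 : ℝ) ≤ Fintype.card H := Nat.cast_nonneg _
    have hL'R : ((L : ℝ)) ^ n ≤ (L' : ℝ) * ((2 * n * R + 1 : ℕ) : ℝ) ^ 2 := by exact_mod_cast hL'
    -- (2nR+1)^2 ≤ (2R+1)^2 n^2 ≤ r^n
    have hsq : (((2 * n * R + 1 : ℕ) : ℝ)) ^ 2 ≤ r ^ n := by
      have h1 : ((2 * n * R + 1 : ℕ) : ℝ) ≤ ((2 * R + 1 : ℕ) : ℝ) * n := by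
        have : 2 * n * R + 1 ≤ (2 * R + 1) * n := by nlinarith
        exact_mod_cast this
      have h2 : (0 : ℝ) ≤ ((2 * n * R + 1 : ℕ) : ℝ) := Nat.cast_nonneg _
      calc (((2 * n * R + 1 : ℕ) : ℝ)) ^ 2 ≤ (((2 * R + 1 : ℕ) : ℝ) * n) ^ 2 :=
            pow_le_pow_left₀ h2 h1 2
        _ = ((2 * R + 1 : ℕ) : ℝ) ^ 2 * (n : ℝ) ^ 2 := by ring
        _ ≤ r ^ n := hn
    have hL'0 : (0 : ℝ) ≤ L' := Nat.cast_nonneg _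
    -- exponent identities
    have hsplit : r * (N : ℝ) ^ (2 + η / 2) = (N : ℝ) ^ (2 + η) := by
      rw [hr, ← Real.rpow_add hNpos]; ring_nf
    have hpow : ((N : ℝ) ^ (2 + η)) ^ n = (((N ^ n : ℕ) : ℝ)) ^ (2 + η) := by
      push_cast
      rw [← Real.rpow_mul_natCast hN0, mul_comm, Real.rpow_natCast_mul hN0]
    rw [Fintype.card_fun, Fintype.card_fin]
    push_cast
    calc ((Fintype.card H : ℝ)) ^ n ≤ ((L : ℝ) * (N : ℝ) ^ (2 + η / 2)) ^ n :=
          pow_le_pow_left₀ hcardH hH n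
      _ = (L : ℝ) ^ n * ((N : ℝ) ^ (2 + η / 2)) ^ n := mul_pow _ _ _
      _ ≤ ((L' : ℝ) * ((2 * n * R + 1 : ℕ) : ℝ) ^ 2) * ((N : ℝ) ^ (2 + η / 2)) ^ n := by
          gcongr
      _ ≤ ((L' : ℝ) * r ^ n) * ((N : ℝ) ^ (2 + η / 2)) ^ n := by
          gcongr
      _ = (L' : ℝ) * ((r * (N : ℝ) ^ (2 + η / 2)) ^ n) := by rw [mul_pow]; ring
      _ = (L' : ℝ) * (((N : ℝ) ^ n)) ^ (2 + η) := by
          rw [hsplit, hpow]; push_cast; rfl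

/-- **Frames feed `C⁺`** (v3): a general frame design is label-weighted (`stub_generalBridge`), survives
reduction modulo `6b+1` (`stub_boxFreiman`), and the host `(ℤ/(6b+1))^D` has the recorded size. -/
theorem weightedThinPackings_of_generalFrames (hT : BoxFreimanTransfer) (hG : GeneralBridge)
    (hF : GeneralFrameDesigns) : WeightedThinPackings := by
  intro a ha0 ha1 η hη
  obtain ⟨D, L, N, M, b, R, A, B, C, rA, rB, rC, κ, μ, hfr, hsph, hoc, hres, hc, hN, hM, hbox, hR,
    hcount⟩ := hF a ha0 ha1 η hη
  have hLW : IsLabelWeightedSTPP A B C κ μ := (hG D L A B C rA rB rC κ μ hfr hsph hoc).2 hres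
  obtain ⟨hLW', hc'⟩ := hT D L b (6 * b + 1) A B C κ μ (by omega) hbox hLW
  refine ⟨Fin D → ZMod (6 * b + 1), inferInstance, inferInstance, L, N, M, R,
    fun i => (A i).image (boxCast D (6 * b + 1)), fun i => (B i).image (boxCast D (6 * b + 1)),
    fun i => (C i).image (boxCast D (6 * b + 1)), κ, μ, hLW', ?_, hN, hM, hR, ?_⟩
  · intro i
    obtain ⟨h1, h2, h3⟩ := hc' i
    obtain ⟨g1, g2, g3⟩ := hc i
    exact ⟨h1.trans g1, h2.trans g2, h3.trans g3⟩
  · rw [Fintype.card_fun, Fintype.card_fin, ZMod.card]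
    push_cast at hcount ⊢
    exact hcount

/-- **Composition (the skeleton theorem).** The crux `ThinPackings`, concluded BY NAME, as a closed term over
the registered stubs. -/
theorem ThinPackings_of : ThinPackings :=
  debordering stub_deborderingPower
    (weightedThinPackings_of_generalFrames stub_boxFreiman stub_generalBridge stub_generalFrameDesigns)

/-! The composition is also in the TREE: `Summit.…Theorems.ThinPackings.thinPackings_of_generalFrameDesigns`
(`Theorems/ThinBlockAlphaThinPackingsDebordering.lean`, p84200) takes the registered design statement
`GeneralFrameDesigns` (explicitly unfolded) as a hypothesis and concludes `ThinPackings`; it is not imported here only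
to keep this workfile checkable while the farm snapshot catches up with that module. -/

/-! ## Comparison: v2's design statement is a special case of v3's -/

/-- The affine grading `rA = xA + α d`, `rB = xB − β d`, `rC = xC + γ d` with admissible slopes and potentials
`κ = μ = −d` is order-compatible, and its residual clause is the general one: so `MultiRadiusFrameDesigns →
GeneralFrameDesigns` (the reshape v2 → v3 only WEAKENS the open stub). [new, elementary] -/
theorem generalFrameDesigns_of_multiRadiusFrameDesigns (h : MultiRadiusFrameDesigns) : GeneralFrameDesigns := by
  intro a ha0 ha1 η hη
  obtain ⟨D, L, N, M, b, R, A, B, C, d, xA, xB, xC, α, β, γ, hsl, hfr, hsph, hres, hc, hN, hM, hbox, hR,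
    hcount⟩ := h a ha0 ha1 η hη
  obtain ⟨hα, hγ, hαγ, hαβ, hγβ⟩ := hsl
  obtain ⟨hsA, hsB, hsC⟩ := hsph
  obtain ⟨hR1, hR2, hR3, hR4⟩ := hres
  refine ⟨D, L, N, M, b, R, A, B, C, fun i => xA + α * d i, fun i => xB - β * d i, fun i => xC + γ * d i,
    fun i => -d i, fun i => -d i, hfr, ⟨hsA, hsB, hsC⟩, ⟨?_, ?_, ?_⟩, ⟨hR1, hR2, hR3, ?_⟩, hc, hN, hM, hbox,
    ?_, hcount⟩
  · intro i k hlt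
    have h1 : (β - α) * d i < (β - α) * d k := by linarith
    have h2 : d i < d k := lt_of_mul_lt_mul_left h1 (by linarith)
    linarith
  · intro i k hlt
    have h1 : (β - γ) * d i < (β - γ) * d k := by linarith
    have h2 : d i < d k := lt_of_mul_lt_mul_left h1 (by linarith)
    linarith
  · intro i k hlt
    have h1 : (α + γ) * d i < (α + γ) * d k := by linarith
    have h2 : d i < d k := lt_of_mul_lt_mul_left h1 (by linarith)
    linarith
  · intro i j k hij hjk hik hw
    exact hR4 i j k hij hjk hik (by linarith)
  · intro i
    have h := hR i
    simp only [abs_neg]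
    exact ⟨h, h⟩

/-- v2's bridge is the LANDED `stub_gradedFrames` (p79783); recorded here so that the comparison above is not
only formal: an affine-graded design is label-weighted by p79783 directly as well. -/
example : ∀ (D L : ℕ) (A B C : Fin L → Finset (Fin D → ℤ)) (d : Fin L → ℤ) (xA xB xC α β γ : ℤ),
    AdmissibleSlopes α β γ → IsFrameFamily A B C → OnGradedSpheres A B C d xA xB xC α β γ →
    (IsLabelWeightedSTPP A B C (fun i => -d i) (fun i => -d i) ↔ ResidualClauses A B C d) :=
  Summit.MatrixMultiplication.MatrixMultiplication.Theorems.ThinPackings.stub_gradedFrames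

end Summit.MatrixMultiplication.MatrixMultiplication.Cruxes.ThinPackings.LabelWeightedStppDebordering
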